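import Mathlib
import Summits.KontsevichZagierPeriods.Zeta5Search.Families.EdgePowers
import HarnessLib

/-!
# ζ(5) search — Families: the generalised cellular integrand as a product of powers of point differences

HONEST FRAMING: systematic search; no irrationality claim unless certified.  This file contains NO statement about
zeta values.  It is the DICTIONARY between `Families/CellularIntegral.lean` (Brown's generalised cellular integrand
`f_σ(a,b) ω_σ` in simplicial coordinates [Brown2016, §1.5, §5.2]) and the edge families of `Families/EdgePowers.lean`
(ANALYTIC half of Brown's convergence criterion, seat P2):

* `cellEdges σ hσ` — the finite edges of the two polygons: the `δ⁰`-edges `{z_i, z_{i+1}}`, `i ≤ ℓ` (index `DEdge`),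
  and the `σδ⁰`-edges `{z_{σ_i}, z_{σ_{i+1}}}` with both endpoints finite (index `SEdge σ`); exponents `cellExp`:
  `a_i` on the former, `−(b_i + 1)` on the latter (the `+1` is the cellular form `ω_σ`);
* `integrand_eq_powProd` — on the open simplex, `integrand σ a b t = (cellEdges σ hσ).powProd (cellExp σ a b) t`
  (edges through `∞` contribute the factor `1`);
* `blockSum_cellEdges` — the block functional of a run of gaps `[p,q)` (= the block of finite points `p,…,q`) is
  `(q − p) + Σ_{p ≤ i, i+1 ≤ q} a_i − Σ_{σ_i, σ_{i+1} ∈ [p,q]} (b_i + 1)`.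
Standard axioms only.
-/

noncomputable section

open MeasureTheory Set Finset

namespace Summit.KontsevichZagierPeriods.Zeta5Search.Families.Cellular

variable {ℓ : ℕ}

/-- Index of the finite `δ⁰`-edges `{z_i, z_{i+1}}`: positions `i ≤ ℓ`. -/
abbrev DEdge (ℓ : ℕ) := {i : Fin (ℓ + 3) // i.val ≤ ℓ}

/-- Index of the finite `σδ⁰`-edges `{z_{σ_i}, z_{σ_{i+1}}}`: both endpoints different from `∞ = ℓ+2`. -/
abbrev SEdge (σ : Fin (ℓ + 3) → Fin (ℓ + 3)) := {i : Fin (ℓ + 3) // (σ i).val ≠ ℓ + 2 ∧ (σ (i + 1)).val ≠ ℓ + 2}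

variable (σ : Fin (ℓ + 3) → Fin (ℓ + 3))

/-- The edge family of the generalised cellular integrand `f_σ(a,b) ω_σ` (finite edges of `δ⁰` and of `σδ⁰`). -/
def cellEdges (hσ : Function.Injective σ) : EdgeFamily ℓ (DEdge ℓ ⊕ SEdge σ) where
  lo := Sum.elim (fun i => i.1.val) (fun i => min (σ i.1).val (σ (i.1 + 1)).val)
  hi := Sum.elim (fun i => i.1.val + 1) (fun i => max (σ i.1).val (σ (i.1 + 1)).val)
  lo_lt_hi := by
    rintro (i | i)
    · simp
    · simp only [Sum.elim_inr]
      exact min_lt_max.2 fun h => succ_ne_self i.1 (hσ (Fin.ext h))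
  hi_le := by
    rintro (i | i)
    · simp only [Sum.elim_inl]; have := i.2; omega
    · simp only [Sum.elim_inr]
      have := i.2; have := (σ i.1).isLt; have := (σ (i.1 + 1)).isLt; omega

/-- The exponents: `a_i` on the `δ⁰`-edges, `−(b_i + 1)` on the `σδ⁰`-edges. -/
def cellExp (a b : Fin (ℓ + 3) → ℤ) : DEdge ℓ ⊕ SEdge σ → ℝ :=
  Sum.elim (fun i => (a i.1 : ℝ)) (fun i => -((b i.1 : ℝ) + 1))

/-! ### Edge factors -/

/-- A finite `δ⁰`-edge factor is the gap `pt (i+1) − pt i`. -/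
theorem ef_succ_of_le (t : Fin ℓ → ℝ) (i : Fin (ℓ + 3)) (hi : i.val ≤ ℓ) :
    ef t i (i + 1) = pt t (i.val + 1) - pt t i.val := by
  have h1 : (i + 1 : Fin (ℓ + 3)).val = i.val + 1 :=
    Fin.val_add_one_of_lt (Fin.lt_def.2 (by rw [Fin.val_last]; omega))
  unfold ef
  rw [if_neg (by omega), h1, max_eq_right (by omega), min_eq_left (by omega)]

/-- A `δ⁰`-edge through `∞` contributes `1`. -/
theorem ef_succ_of_gt (t : Fin ℓ → ℝ) (i : Fin (ℓ + 3)) (hi : ¬ i.val ≤ ℓ) : ef t i (i + 1) = 1 := by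
  unfold ef
  rw [if_pos]
  by_cases h : i.val = ℓ + 2
  · exact Or.inl h
  · right
    have hlt : i < Fin.last (ℓ + 2) := Fin.lt_def.2 (by rw [Fin.val_last]; omega)
    rw [Fin.val_add_one_of_lt hlt]; omega

/-- A finite `σδ⁰`-edge factor is `pt (max) − pt (min)`. -/
theorem ef_sigma_of_finite (t : Fin ℓ → ℝ) (i : Fin (ℓ + 3))
    (hi : (σ i).val ≠ ℓ + 2 ∧ (σ (i + 1)).val ≠ ℓ + 2) :
    ef t (σ i) (σ (i + 1)) = pt t (max (σ i).val (σ (i + 1)).val) - pt t (min (σ i).val (σ (i + 1)).val) := by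
  unfold ef
  rw [if_neg (by omega)]

/-- A `σδ⁰`-edge through `∞` contributes `1`. -/
theorem ef_sigma_of_infinite (t : Fin ℓ → ℝ) (i : Fin (ℓ + 3))
    (hi : ¬ ((σ i).val ≠ ℓ + 2 ∧ (σ (i + 1)).val ≠ ℓ + 2)) : ef t (σ i) (σ (i + 1)) = 1 := by
  unfold ef
  rw [if_pos (by omega)]

/-! ### The dictionary -/

/-- Numerator over the finite `δ⁰`-edges. -/
theorem num_eq_prod_subtype (a : Fin (ℓ + 3) → ℤ) (t : Fin ℓ → ℝ) :
    num a t = ∏ i : DEdge ℓ, (pt t (i.1.val + 1) - pt t i.1.val) ^ a i.1 := by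
  unfold num
  rw [← Fintype.prod_subtype_mul_prod_subtype (fun i : Fin (ℓ + 3) => i.val ≤ ℓ)]
  have h2 : ∏ i : {x : Fin (ℓ + 3) // ¬ x.val ≤ ℓ}, ef t i.1 (i.1 + 1) ^ a i.1 = 1 :=
    Finset.prod_eq_one fun i _ => by rw [ef_succ_of_gt t i.1 i.2, one_zpow]
  rw [h2, mul_one]
  exact Finset.prod_congr rfl fun i _ => by rw [ef_succ_of_le t i.1 i.2]

/-- Denominator times the cellular form over the finite `σδ⁰`-edges (on the open simplex, `σ` injective). -/
theorem den_mul_formDen_eq_prod_subtype (hσ : Function.Injective σ) (b : Fin (ℓ + 3) → ℤ) {t : Fin ℓ → ℝ}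
    (ht : t ∈ openSimplex ℓ) :
    den σ b t * formDen σ t =
      ∏ i : SEdge σ, (pt t (max (σ i.1).val (σ (i.1 + 1)).val) - pt t (min (σ i.1).val (σ (i.1 + 1)).val)) ^
        (b i.1 + 1) := by
  unfold den formDen
  rw [← Finset.prod_mul_distrib]
  have hne : ∀ i : Fin (ℓ + 3), ef t (σ i) (σ (i + 1)) ≠ 0 := fun i =>
    (ef_pos ht (fun e => succ_ne_self i (hσ e))).ne'
  have : ∀ i : Fin (ℓ + 3), ef t (σ i) (σ (i + 1)) ^ b i * ef t (σ i) (σ (i + 1)) =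
      ef t (σ i) (σ (i + 1)) ^ (b i + 1) := fun i => by rw [zpow_add_one₀ (hne i)]
  simp_rw [this]
  rw [← Fintype.prod_subtype_mul_prod_subtype (fun i : Fin (ℓ + 3) => (σ i).val ≠ ℓ + 2 ∧ (σ (i + 1)).val ≠ ℓ + 2)]
  have h2 : ∏ i : {x : Fin (ℓ + 3) // ¬ ((σ x).val ≠ ℓ + 2 ∧ (σ (x + 1)).val ≠ ℓ + 2)},
      ef t (σ i.1) (σ (i.1 + 1)) ^ (b i.1 + 1) = 1 :=
    Finset.prod_eq_one fun i _ => by rw [ef_sigma_of_infinite σ t i.1 i.2, one_zpow]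
  rw [h2, mul_one]
  exact Finset.prod_congr rfl fun i _ => by rw [ef_sigma_of_finite σ t i.1 i.2]

/-- **Dictionary**: on the open simplex the generalised cellular integrand is the product of powers of point
differences attached to `cellEdges`. [Brown2016, §1.5 (1.4), §5.2 (5.4), in simplicial coordinates] -/
theorem integrand_eq_powProd (hσ : Function.Injective σ) (a b : Fin (ℓ + 3) → ℤ) {t : Fin ℓ → ℝ}
    (ht : t ∈ openSimplex ℓ) :
    integrand σ a b t = (cellEdges σ hσ).powProd (cellExp σ a b) t := by
  unfold integrand EdgeFamily.powProd
  rw [div_div, den_mul_formDen_eq_prod_subtype σ hσ b ht, num_eq_prod_subtype, Fintype.prod_sum_type,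
    div_eq_mul_inv, ← Finset.prod_inv_distrib]
  congr 1
  · refine Finset.prod_congr rfl fun i _ => ?_
    simp only [cellEdges, cellExp, EdgeFamily.len, Sum.elim_inl]
    rw [← Real.rpow_intCast]
  · refine Finset.prod_congr rfl fun i _ => ?_
    simp only [cellEdges, cellExp, EdgeFamily.len, Sum.elim_inr]
    rw [← zpow_neg, ← Real.rpow_intCast]
    push_cast
    ring_nf

/-- The cellular integrand is integrable on the simplex iff the associated product of powers is. -/
theorem integrableOn_integrand_iff_powProd (hσ : Function.Injective σ) (a b : Fin (ℓ + 3) → ℤ) :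
    IntegrableOn (integrand σ a b) (openSimplex ℓ) ↔
      IntegrableOn ((cellEdges σ hσ).powProd (cellExp σ a b)) (openSimplex ℓ) :=
  integrableOn_congr_fun (fun _ ht => integrand_eq_powProd σ hσ a b ht) (measurableSet_openSimplex ℓ)

/-! ### Block functionals of the cellular edge family -/

/-- The block functional of the run of gaps `[p, q)` in the cellular dictionary. -/
theorem blockSum_cellEdges (hσ : Function.Injective σ) (a b : Fin (ℓ + 3) → ℤ) {p q : ℕ} (hq : q ≤ ℓ + 1) :
    (cellEdges σ hσ).blockSum (cellExp σ a b) (gapRun ℓ p q) =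
      ((q - p : ℕ) : ℝ) + (∑ i : Fin (ℓ + 3), if p ≤ i.val ∧ i.val + 1 ≤ q then (a i : ℝ) else 0) -
        ∑ i : Fin (ℓ + 3), if p ≤ min (σ i).val (σ (i + 1)).val ∧ max (σ i).val (σ (i + 1)).val ≤ q
          then ((b i : ℝ) + 1) else 0 := by
  unfold EdgeFamily.blockSum
  rw [card_gapRun p q hq, Finset.sum_filter, Fintype.sum_sum_type]
  simp only [EdgeFamily.span_subset_gapRun_iff]
  have hD : ∑ i : DEdge ℓ, (if p ≤ (cellEdges σ hσ).lo (Sum.inl i) ∧ (cellEdges σ hσ).hi (Sum.inl i) ≤ q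
        then cellExp σ a b (Sum.inl i) else 0) =
      ∑ i : Fin (ℓ + 3), if p ≤ i.val ∧ i.val + 1 ≤ q then (a i : ℝ) else 0 := by
    rw [← Fintype.sum_subtype_add_sum_subtype (fun i : Fin (ℓ + 3) => i.val ≤ ℓ)
      (fun i : Fin (ℓ + 3) => if p ≤ i.val ∧ i.val + 1 ≤ q then (a i : ℝ) else 0)]
    have h0 : ∑ i : {x : Fin (ℓ + 3) // ¬ x.val ≤ ℓ}, (if p ≤ i.1.val ∧ i.1.val + 1 ≤ q then (a i.1 : ℝ) else 0)
        = 0 := Finset.sum_eq_zero fun i _ => by rw [if_neg]; have := i.2; omega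
    rw [h0, add_zero]
    rfl
  have hS : ∑ i : SEdge σ, (if p ≤ (cellEdges σ hσ).lo (Sum.inr i) ∧ (cellEdges σ hσ).hi (Sum.inr i) ≤ q
        then cellExp σ a b (Sum.inr i) else 0) =
      - ∑ i : Fin (ℓ + 3), if p ≤ min (σ i).val (σ (i + 1)).val ∧ max (σ i).val (σ (i + 1)).val ≤ q
          then ((b i : ℝ) + 1) else 0 := by
    rw [← Fintype.sum_subtype_add_sum_subtype (fun i : Fin (ℓ + 3) => (σ i).val ≠ ℓ + 2 ∧ (σ (i + 1)).val ≠ ℓ + 2)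
      (fun i : Fin (ℓ + 3) => if p ≤ min (σ i).val (σ (i + 1)).val ∧ max (σ i).val (σ (i + 1)).val ≤ q
          then ((b i : ℝ) + 1) else 0)]
    have h0 : ∑ i : {x : Fin (ℓ + 3) // ¬ ((σ x).val ≠ ℓ + 2 ∧ (σ (x + 1)).val ≠ ℓ + 2)},
        (if p ≤ min (σ i.1).val (σ (i.1 + 1)).val ∧ max (σ i.1).val (σ (i.1 + 1)).val ≤ q
          then ((b i.1 : ℝ) + 1) else 0) = 0 :=
      Finset.sum_eq_zero fun i _ => by
        rw [if_neg]
        have := i.2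
        rw [not_and_or, not_ne_iff, not_ne_iff] at this
        rcases this with h | h <;> · rw [h]; omega
    rw [h0, add_zero, ← Finset.sum_neg_distrib]
    refine Finset.sum_congr rfl fun i _ => ?_
    simp only [cellEdges, cellExp, Sum.elim_inr]
    split_ifs <;> simp
  rw [hD, hS]
  ring

end Summit.KontsevichZagierPeriods.Zeta5Search.Families.Cellular
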